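import Literature.Computability.Cryptography.SamplingProblems
import Literature.Computability.Cryptography.QuantumCircuitProofs
import Literature.Computability.Cryptography.QubitRegisterCliffordTProofs
import Literature.Computability.QuantumComplexity.SimUniformity
import Literature.Computability.Complexity.Transducers
import Literature.Computability.Complexity.TimeBoundsProofs
import HarnessLib

/-!
# Uniform `SampP`, and `SampP ⊆ SampBQP` for uniform samplers

Companion of `SamplingProblems.lean` (Aaronson–Arkhipov 2013, Def. 2.3: the classes `SampP`,
`SampBQP`). That file vendors the named fact `SampP_subset_SampBQP : SampP ⊆ SampBQP`, which is
**mis-stated**: it is false over the tree's definitions, while the printed inclusion concerns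
*uniform* machines. This file records the discrepancy, vendors the corrected statement under a
new name and proves it:

* `UniformSampP` — `SampP` with a *uniform* sampler: `IsPPT A id` **and** an exactly polynomial
  coin budget `∃ q, ∀ n, A.coinLen n = q.eval n` (the idiom of `mem_BPP_iff_randAlg`,
  `UniformApproxBosonSampling`, `UniformIQPMultiplicativeSimulation`); `UniformSampP ⊆ SampP`.
* `UniformSampP_subset_SampBQP : Prop := UniformSampP ⊆ SampBQP` — the corrected statement, with
  the discrepancy spelled out in its docstring — and its discharge
  `UniformSampP_subset_SampBQP_holds`, along the proof of `BPP ⊆ BQP` (Bernstein–Vazirani 1997,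
  Thm. 8.3): Hadamard coins, then the classical computation; here the classical computation is
  the polynomial-time post-processing that `SampBQP` allows, so no reversible compilation is
  needed.

**Why `SampP ⊆ SampBQP` fails as formalised.** `IsPPT A id = RandAlg.IsPolyTime id id` asks
for polynomial time of `(y, r) ↦ A.run y r` and for a polynomial *bound* on `A.coinLen`, nothing
else; `RandAlg.outputPMF` feeds `A.run` exactly `coinLen |y|` uniform coins, and `A.run` can
count them. For a non-computable `H : ℕ → Bool` let `coinLen n := ∑_{j ≤ log₂ n} H(j) 2^j`
(`≤ 2n + 1`) and let `A.run ⟨x, 1^k⟩ r := [bit_j |r|]` if `|x| = 2^j`, `[0]` otherwise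
(polynomial time). Since `|⟨x, 1^k⟩| = 2|x| + 2 + k > 2^{j+1}`, bit `j` of the coin count is
`H(j)`: `A.samplePMF x k = pure [H j]` for every `k`, so `D x := pure [H(log₂ |x|)]` (on
powers of two) lies in the tree's `SampP` with distance `0`. But for `D ∈ SampBQP` the law of
the post-processed output on `⟨x, 1^3⟩` is computable exactly (the description `1ⁿ ↦ Cₙ` and the
post-processing are `PolyTimeComputable`, Clifford+T amplitudes lie in `ℚ(ζ₈)`), and its bit of
mass `≥ 2/3` is `H(log₂ |x|)` — so `H` would be computable. The same defect of advice-taking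
`RandAlg`s is recorded for quantum-advantage S20–S22 (`QuantumComplexity/Sampling.lean`, module
docstring; `BosonSamplingHardness.lean`; `IQPPostselection.lean`) and in the docstring of
`mem_BPP_iff_randAlg`; the cure is the same exact-polynomial coin budget.

**The proof of the corrected statement** (namespace `SampPSim`). For a uniform sampler `A`
with `A.coinLen = q`:

* `sepCoinFamily A.coinLen` — on inputs `y` of length `n`, `1 + q n` ancillas: wire `n` idle (a
  separator reading `0`), one Hadamard gate on each coin wire `n + 1 + j`; its output state is
  the uniform superposition of the labels `y 0 r` (`runOn_sepCoin`, from
  `hadamards_mulVec_basisState` of `BQPProofs.lean`), so by the Born rule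
  (`QCircuit.outputPMF_apply_holds`) the measured string is `y ++ 0 :: r` for a uniform coin
  string `r ∈ {0,1}^{q n}` (`kernel_sepCoin`), and any post-processing reading this as "run `A`
  on `y` with coins `r`" reproduces `A.outputPMF id y` exactly (`kernel_sepCoin_map`);
* `post A := uncurry A.run ∘ parse`, where `parse` splits `⟨x, 1^k⟩ 0 r` at the separator — the
  doubled bits of `x`, the pair `0 1`, the unary block `1^k`, then the first `0` (`parse_layout`);
  `post A` is polynomial time (`post_polyTime`): the string map `z ↦ boolPair (parse z).1
  (parse z).2` is a finite-state transduction (`repairT`, `repairT_eval`;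
  `FST.polyTimeComputable_eval` of `Transducers.lean`), composed with the machine of `A`
  (`PolyTimeComputable.comp_holds`);
* uniformity (`sepCoinFamily_isUniform`): the description stream `descTok` of the family is
  generated by a five-line counter program `genS q` (`out_genS`), and generated streams are
  polynomial-time (`QCircuitFamily.isUniform_of_gen` of `QuantumCircuitTokens.lean`, with the
  statement builders of `SimUniformity.lean`).

## References

* S. Aaronson, A. Arkhipov, *The computational complexity of linear optics*, Theory of
  Computing 9 (2013) 143–252, §2.2, Def. 2.3 (p. 162), Thm. 2.6 (p. 163).
* S. Aaronson, *The equivalence of sampling and searching*, CSR 2011 (arXiv:1009.5104), §2.1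
  and the proof of Thm. 3 ("Hence `SampP = SampBQP`").
* E. Bernstein, U. Vazirani, *Quantum complexity theory*, SIAM J. Comput. 26 (1997), Thm. 8.3
  (`BPP ⊆ BQP`, proof).
* S. Arora, B. Barak, *Computational Complexity: A Modern Approach*, CUP 2009, §6.1–6.2,
  Def. 6.12 (uniform circuit descriptions), Def. 7.1/7.3 (random tapes).

## Design notes

* The separator wire makes the measured string self-delimiting (`⟨x, 1^k⟩` ends with the unary
  block `1^k`, which a left-to-right parser cannot tell from leading `1`-coins); it costs one
  idle qubit and keeps the post-processing a Mealy machine.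
* The family is built on `A.coinLen` itself (so that `kernel_sepCoin_map` is an equality of
  `PMF`s without transport); the polynomial `q` enters only through uniformity.
* Nothing here modifies `SamplingProblems.lean`; `SampP_subset_SampBQP` is left as vendored and
  implies the corrected statement (`UniformSampP_subset_SampBQP_of_sampP_subset`).
-/

noncomputable section

namespace Literature.Computability.Cryptography

open _root_.Computability Complexity QuantumComplexity Matrix

namespace SampPSim

/-! ### The separator–coin family -/

/-- The `j`-th coin wire of the separator–coin layout with `n` input wires, one separator wire
and `m` coin wires: wire `n + 1 + j`. [folklore] -/
def coinWire (n m : ℕ) (j : Fin m) : Fin (n + (1 + m)) :=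
  Fin.natAdd n (Fin.natAdd 1 j)

/-- The value of the `j`-th coin wire is `n + 1 + j`. [folklore] -/
@[simp] theorem val_coinWire (n m : ℕ) (j : Fin m) : (coinWire n m j : ℕ) = n + 1 + j := by
  simp [coinWire, Nat.add_assoc]

/-- Distinct coins sit on distinct wires. [folklore] -/
theorem coinWire_injective (n m : ℕ) : Function.Injective (coinWire n m) := by
  intro a b h
  have := congrArg Fin.val h
  simp only [val_coinWire] at this
  exact Fin.ext (by omega)

/-- The list of the coin wires, in order. [folklore] -/
def coinWires (n m : ℕ) : List (Fin (n + (1 + m))) :=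
  (List.finRange m).map (coinWire n m)

/-- There are `m` coin wires. [folklore] -/
@[simp] theorem length_coinWires (n m : ℕ) : (coinWires n m).length = m := by
  simp [coinWires]

/-- The coin wires are pairwise distinct. [folklore] -/
theorem coinWires_nodup (n m : ℕ) : (coinWires n m).Nodup :=
  (List.nodup_finRange m).map (coinWire_injective n m)

/-- **The separator–coin family** with coin budget `c`: on inputs of length `n` it has
`1 + c n` ancilla wires — wire `n` is left idle (it reads `0`, a separator) and each of the
`c n` coin wires `n + 1 + j` carries one Hadamard gate; all wires are measured.
(Bernstein–Vazirani 1997, proof of Thm. 8.3: "Fourier transform" of the coin track.)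
[cite: BernsteinVazirani1997SICOMP, Thm. 8.3 (proof)] -/
abbrev sepCoinFamily (c : ℕ → ℕ) : QCircuitFamily cliffordT where
  ancillas n := 1 + c n
  circ n := ⟨(coinWires n (c n)).map hOn⟩

/-- The basis label `x 0 r` of the separator–coin register: input `x`, separator `0`,
coins `r`. [folklore] -/
def label {n m : ℕ} (x : QReg n) (r : QReg m) : QReg (n + (1 + m)) :=
  Fin.append x (Fin.append (fun _ : Fin 1 => false) r)

variable {n m : ℕ}

/-- The label carries the input on the input wires. [folklore] -/
@[simp] theorem label_castAdd (x : QReg n) (r : QReg m) (i : Fin n) :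
    label x r (Fin.castAdd (1 + m) i) = x i := by
  simp [label]

/-- The label reads `0` on the separator wire. [folklore] -/
@[simp] theorem label_sep (x : QReg n) (r : QReg m) :
    label x r (Fin.natAdd n (Fin.castAdd m (0 : Fin 1))) = false := by
  simp [label]

/-- The label carries the coins on the coin wires. [folklore] -/
@[simp] theorem label_coinWire (x : QReg n) (r : QReg m) (j : Fin m) :
    label x r (coinWire n m j) = r j := by
  simp [label, coinWire]

/-- The label is injective in the coins. [folklore] -/
theorem label_injective (x : QReg n) : Function.Injective (label (m := m) x) := by
  intro r r' h
  funext j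
  have := congrFun h (coinWire n m j)
  simpa using this

/-- The padded input `x 0^{1+m}` is the label with all coins `0`. [folklore] -/
theorem padInput_eq_label (x : QReg n) : padInput x (1 + m) = label x (fun _ => false) := by
  funext i
  simp only [padInput, label]
  refine Fin.addCases (fun i => ?_) (fun j => ?_) i
  · simp
  · simp only [Fin.append_right]
    refine Fin.addCases (fun j => ?_) (fun j => ?_) j <;> simp

/-- The padded input vanishes on the coin wires. [folklore] -/
theorem padInput_coinWire (x : QReg n) (j : Fin m) : padInput x (1 + m) (coinWire n m j) = false := by
  rw [padInput_eq_label, label_coinWire]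

/-- A register state agrees with the padded input off the coin wires iff it is a label
`x 0 r` (namely with `r` its own coin track). [folklore] -/
theorem agree_off_coins_iff (x : QReg n) (z : QReg (n + (1 + m))) :
    (∀ i, i ∉ coinWires n m → z i = padInput x (1 + m) i) ↔ z = label x (fun j => z (coinWire n m j)) := by
  constructor
  · intro h
    funext i
    by_cases hi : i ∈ coinWires n m
    · obtain ⟨j, -, rfl⟩ := List.mem_map.1 hi
      simp
    · rw [h i hi, padInput_eq_label]
      simp only [label]
      revert hi
      refine Fin.addCases (fun i _ => by simp) (fun j => ?_) i
      refine Fin.addCases (fun j _ => by simp) (fun j hj => ?_) j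
      exact absurd (List.mem_map.2 ⟨j, List.mem_finRange j, rfl⟩) hj
  · intro h i hi
    rw [h, padInput_eq_label]
    simp only [label]
    revert hi
    refine Fin.addCases (fun i _ => by simp) (fun j => ?_) i
    refine Fin.addCases (fun j _ => by simp) (fun j hj => ?_) j
    exact absurd (List.mem_map.2 ⟨j, List.mem_finRange j, rfl⟩) hj

/-- **The output state of the separator–coin circuit** on `|x⟩|0^{1+m}⟩`: the uniform
superposition `2^{-m/2} ∑_r |x 0 r⟩` — amplitude `2^{-m/2}` on the labels, `0` elsewhere.
(Bernstein–Vazirani 1997, proof of Thm. 8.3; Nielsen–Chuang 2010, §1.4.4.)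
[cite: BernsteinVazirani1997SICOMP, Thm. 8.3 (proof)] -/
theorem runOn_sepCoin (c : ℕ → ℕ) (n : ℕ) (x : QReg n) (z : QReg (n + (1 + c n))) :
    ((sepCoinFamily c).circ n).runOn 0 (basisState (padInput x (1 + c n))) z =
      if z = label x (fun j => z (coinWire n (c n) j)) then invSqrt2 ^ (c n) else 0 := by
  rw [QCircuit.runOn, show ((sepCoinFamily c).circ n) = ⟨(coinWires n (c n)).map hOn⟩ from rfl,
    hadamards_mulVec_basisState _ (coinWires_nodup n (c n)) _
      (fun i hi => by obtain ⟨j, -, rfl⟩ := List.mem_map.1 hi; exact padInput_coinWire x j)]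
  dsimp only
  rw [length_coinWires]
  exact if_congr (agree_off_coins_iff x z) rfl rfl

/-- The number of basis states of `m` qubits is `2^m`, in `ℝ≥0∞`. [folklore] -/
private theorem card_QReg_ennreal (m : ℕ) : (Fintype.card (QReg m) : ENNReal) = 2 ^ m := by
  simp [QReg]

/-- `(1/2)^m`, as an extended nonnegative real, is `(2^m)⁻¹`. [folklore] -/
private theorem ofReal_half_pow (m : ℕ) : ENNReal.ofReal ((1 / 2 : ℝ) ^ m) = ((2 : ENNReal) ^ m)⁻¹ := by
  rw [ENNReal.ofReal_pow (by norm_num), one_div, ENNReal.ofReal_inv_of_pos (by norm_num),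
    ENNReal.ofReal_ofNat, ENNReal.inv_pow]

/-- **The output distribution of the separator–coin circuit** on `|x⟩|0^{1+m}⟩, measured on
all wires, is the law of the label `x 0 r` of a uniformly random coin track `r`.
(Bernstein–Vazirani 1997, proof of Thm. 8.3; Born rule, Nielsen–Chuang 2010, §2.2.5.)
[cite: BernsteinVazirani1997SICOMP, Thm. 8.3 (proof)] -/
theorem outputPMF_sepCoin (c : ℕ → ℕ) (n : ℕ) (x : QReg n) :
    ((sepCoinFamily c).circ n).outputPMF 0 x =
      (PMF.uniformOfFintype (QReg (c n))).map (label x) := by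
  refine PMF.ext fun z => ?_
  rw [@QCircuit.outputPMF_apply_holds cliffordT n (1 + c n) cliffordT_isUnitary_holds 0 _ x z,
    runOn_sepCoin, PMF.map_apply, tsum_fintype]
  simp only [PMF.uniformOfFintype_apply, card_QReg_ennreal]
  by_cases hz : z = label x (fun j => z (coinWire n (c n) j))
  · rw [if_pos hz, norm_invSqrt2_pow_sq, ofReal_half_pow, Finset.sum_eq_single (fun j => z (coinWire n (c n) j))]
    · rw [if_pos hz]
    · intro r _ hr
      exact if_neg fun h => hr (label_injective x (h.symm.trans hz))
    · intro h; exact absurd (Finset.mem_univ _) h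
  · rw [if_neg hz, norm_zero, zero_pow two_ne_zero, ENNReal.ofReal_zero, eq_comm]
    exact Finset.sum_eq_zero fun r _ => if_neg fun h => hz (by
      rw [h]; congr 1; funext j; simp)

/-- The read-out of the label `x 0 r` is the string `x ++ 0 :: r`. [folklore] -/
theorem ofFn_label (x : QReg n) (r : QReg m) :
    List.ofFn (label x r) = List.ofFn x ++ false :: List.ofFn r := by
  simp [label]

/-- **The classical kernel of the separator–coin family**: on input `y` the measured string is
`y ++ 0 :: r` for a uniformly random coin string `r ∈ {0,1}^{c |y|}`.
(Bernstein–Vazirani 1997, proof of Thm. 8.3.) [cite: BernsteinVazirani1997SICOMP, Thm. 8.3 (proof)] -/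
theorem kernel_sepCoin (c : ℕ → ℕ) (y : List Bool) :
    (sepCoinFamily c).kernel 0 y =
      (PMF.uniformOfFintype (QReg (c y.length))).map fun r => y ++ false :: List.ofFn r := by
  rw [QCircuitFamily.kernel, outputPMF_sepCoin, PMF.map_comp]
  congr 1
  funext r
  simp [Function.comp, ofFn_label]

/-- The uniform distribution is transported to the uniform distribution by an equivalence.
[folklore] -/
private theorem uniformOfFintype_map_equiv {α β : Type*} [Fintype α] [Fintype β] [Nonempty α] [Nonempty β]
    (e : α ≃ β) : (PMF.uniformOfFintype α).map e = PMF.uniformOfFintype β := by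
  refine PMF.ext fun b => ?_
  rw [PMF.map_apply, tsum_fintype, PMF.uniformOfFintype_apply]
  simp only [PMF.uniformOfFintype_apply, Fintype.card_congr e]
  rw [Finset.sum_eq_single (e.symm b)]
  · simp
  · intro a _ ha
    exact if_neg fun h => ha (by rw [h]; simp)
  · intro h; exact absurd (Finset.mem_univ _) h

/-- Uniform coins read off a register and uniform coin *strings* have the same law under any
read-out `g` of the coin string. [folklore] -/
theorem map_uniform_QReg (m : ℕ) {β : Type} (g : List Bool → β) :
    (PMF.uniformOfFintype (QReg m)).map (fun r => g (List.ofFn r)) =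
      (PMF.uniformOfFintype (List.Vector Bool m)).map fun v => g v.toList := by
  rw [← uniformOfFintype_map_equiv (Equiv.vectorEquivFin Bool m).symm, PMF.map_comp]
  congr 1
  funext r
  simp only [Function.comp]
  congr 1
  exact (List.Vector.toList_ofFn r).symm

/-- **Coins as a random tape.** Post-processing the kernel of the separator–coin family with a
map reading `y ++ 0 :: r` as "run `A` on `y` with coins `r`" gives exactly the output
distribution of the randomized algorithm `A` (whose coin budget is the family's).
(Bernstein–Vazirani 1997, proof of Thm. 8.3; Arora–Barak 2009, Def. 7.1.)
[cite: BernsteinVazirani1997SICOMP, Thm. 8.3 (proof)] -/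
theorem kernel_sepCoin_map (A : RandAlg (List Bool) (List Bool)) (post : List Bool → List Bool)
    (y : List Bool) (hpost : ∀ r : List Bool, post (y ++ false :: r) = A.run y r) :
    ((sepCoinFamily A.coinLen).kernel 0 y).map post = A.outputPMF id y := by
  rw [kernel_sepCoin, PMF.map_comp, RandAlg.outputPMF]
  simp only [Function.comp_def, hpost]
  exact map_uniform_QReg (A.coinLen y.length) (A.run y)


/-! ### The classical post-processing: parsing `⟨x, 1^k⟩ 0 r` -/

/-- States of the parser: inside the doubled block of `⟨x, 1^k⟩` at an even position (`ev`) or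
with one symbol pending (`od b`), inside the unary block (`un`), copying the coins (`cp`).
[folklore] -/
inductive PState
  | ev
  | od (b : Bool)
  | un
  | cp
  deriving DecidableEq, Fintype

/-- `parseAux s z`: reading `z` from the parser state `s`, the part of the sampler input still to
come and the coin string, if the separator `0` closing the unary block is reached; `none`
otherwise. The separator itself is dropped. [folklore] -/
def parseAux : PState → List Bool → Option (List Bool × List Bool)
  | .cp, z => some ([], z)
  | .ev, b :: z => (parseAux (.od b) z).map fun p => (b :: p.1, p.2)
  | .od b, b' :: z => (parseAux (if b = b' then .ev else .un) z).map fun p => (b' :: p.1, p.2)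
  | .un, true :: z => (parseAux .un z).map fun p => (true :: p.1, p.2)
  | .un, false :: z => some ([], z)
  | .ev, [] => none
  | .od _, [] => none
  | .un, [] => none

/-- `parse z = (y, r)` if `z = y ++ 0 :: r` with `y = ⟨x, 1^k⟩` a sampler input; junk value
`([], [])` on strings not of this form. [folklore] -/
def parse (z : List Bool) : List Bool × List Bool :=
  (parseAux .ev z).getD ([], [])

/-- The unary block followed by the separator is parsed off correctly. [folklore] -/
theorem parseAux_un (k : ℕ) (r : List Bool) :
    parseAux .un (unaryEncodeNat k ++ false :: r) = some (unaryEncodeNat k, r) := by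
  induction k with
  | zero => rfl
  | succ k ih => simp [unaryEncodeNat, parseAux, ih]

/-- A sampler input followed by the separator is parsed off correctly. [folklore] -/
theorem parseAux_ev (x : List Bool) (k : ℕ) (r : List Bool) :
    parseAux .ev (boolPair x (unaryEncodeNat k) ++ false :: r) =
      some (boolPair x (unaryEncodeNat k), r) := by
  induction x with
  | nil => simp [boolPair, parseAux, parseAux_un]
  | cons b x ih =>
    have e : boolPair (b :: x) (unaryEncodeNat k) = b :: b :: boolPair x (unaryEncodeNat k) := by
      simp [boolPair]
    rw [e]
    simp [parseAux, ih]

/-- **The parser inverts the layout of the measured string**: `⟨x, 1^k⟩ 0 r ↦ (⟨x, 1^k⟩, r)`.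
[folklore] -/
theorem parse_layout (x : List Bool) (k : ℕ) (r : List Bool) :
    parse (boolPair x (unaryEncodeNat k) ++ false :: r) = (boolPair x (unaryEncodeNat k), r) := by
  simp [parse, parseAux_ev]

/-- Transition function of the re-pairing transducer: double every symbol of the sampler input,
replace the separator `0` by the `boolPair` separator `0 1`, copy the coins. [folklore] -/
def repairStep : PState → Bool → PState × List Bool
  | .ev, b => (.od b, [b, b])
  | .od b, b' => (if b = b' then .ev else .un, [b', b'])
  | .un, true => (.un, [true, true])
  | .un, false => (.cp, [false, true])
  | .cp, b => (.cp, [b])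

/-- **The re-pairing transducer** `⟨x, 1^k⟩ 0 r ↦ boolPair ⟨x, 1^k⟩ r` (on malformed inputs, which
never reach the copying state, the body is discarded and `boolPair [] [] = 0 1` is output).
(Hopcroft–Ullman 1979, §2.7: Mealy machines.) [folklore] -/
def repairT : FST PState Bool Bool where
  init := .ev
  step := repairStep
  front s := if s = .cp then [] else [false, true]
  keep s := decide (s = .cp)

/-- The initial state of `repairT` (definitional). [folklore] -/
@[simp] theorem repairT_init : repairT.init = .ev := rfl

/-- The final word of `repairT` (definitional). [folklore] -/
@[simp] theorem repairT_front (s : PState) :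
    repairT.front s = if s = .cp then [] else [false, true] := rfl

/-- The keep flag of `repairT` (definitional). [folklore] -/
@[simp] theorem repairT_keep (s : PState) : repairT.keep s = decide (s = .cp) := rfl

/-- One step of the run of `repairT`. [folklore] -/
theorem repairT_run_cons (s : PState) (b : Bool) (z : List Bool) :
    repairT.run s (b :: z) =
      ((repairT.run (repairStep s b).1 z).1,
        (repairStep s b).2 ++ (repairT.run (repairStep s b).1 z).2) := rfl

/-- In the copying state `repairT` copies. [folklore] -/
theorem run_cp (z : List Bool) : repairT.run .cp z = (.cp, z) := by
  induction z with
  | nil => rfl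
  | cons b z ih => rw [repairT_run_cons]; simp [repairStep, ih]

/-- From a parser state that reaches the separator, `repairT` ends in the copying state having
emitted `boolPair` of the parsed pieces. [folklore] -/
theorem run_of_parseAux_some : ∀ (z : List Bool) (s : PState) (p : List Bool × List Bool),
    s ≠ .cp → parseAux s z = some p → repairT.run s z = (.cp, boolPair p.1 p.2)
  | [], s, p, hs, h => by cases s <;> simp [parseAux] at h hs
  | b :: z, .ev, p, _, h => by
    cases hq : parseAux (.od b) z with
    | none => simp [parseAux, hq] at h
    | some p' =>
      simp only [parseAux, hq, Option.map_some, Option.some.injEq] at h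
      subst h
      rw [repairT_run_cons]
      simp [repairStep, run_of_parseAux_some z (.od b) p' (by simp) hq, boolPair]
  | b :: z, .od b₀, p, _, h => by
    have hs' : (if b₀ = b then PState.ev else PState.un) ≠ .cp := by split <;> simp
    cases hq : parseAux (if b₀ = b then .ev else .un) z with
    | none => simp [parseAux, hq] at h
    | some p' =>
      simp only [parseAux, hq, Option.map_some, Option.some.injEq] at h
      subst h
      rw [repairT_run_cons]
      simp [repairStep, run_of_parseAux_some z _ p' hs' hq, boolPair]
  | true :: z, .un, p, _, h => by
    cases hq : parseAux .un z with
    | none => simp [parseAux, hq] at h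
    | some p' =>
      simp only [parseAux, hq, Option.map_some, Option.some.injEq] at h
      subst h
      rw [repairT_run_cons]
      simp [repairStep, run_of_parseAux_some z .un p' (by simp) hq, boolPair]
  | false :: z, .un, p, _, h => by
    simp only [parseAux, Option.some.injEq] at h
    subst h
    rw [repairT_run_cons]
    simp [repairStep, run_cp, boolPair]
  | _ :: _, .cp, _, hs, _ => absurd rfl hs

/-- From a parser state that does not reach the separator, `repairT` does not end in the
copying state. [folklore] -/
theorem run_of_parseAux_none : ∀ (z : List Bool) (s : PState),
    s ≠ .cp → parseAux s z = none → (repairT.run s z).1 ≠ .cp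
  | [], s, hs, _ => by simpa [FST.run] using hs
  | b :: z, .ev, _, h => by
    cases hq : parseAux (.od b) z with
    | some p' => simp [parseAux, hq] at h
    | none =>
      rw [repairT_run_cons]
      simpa [repairStep] using run_of_parseAux_none z (.od b) (by simp) hq
  | b :: z, .od b₀, _, h => by
    have hs' : (if b₀ = b then PState.ev else PState.un) ≠ .cp := by split <;> simp
    cases hq : parseAux (if b₀ = b then .ev else .un) z with
    | some p' => simp [parseAux, hq] at h
    | none =>
      rw [repairT_run_cons]
      simpa [repairStep] using run_of_parseAux_none z _ hs' hq
  | true :: z, .un, _, h => by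
    cases hq : parseAux .un z with
    | some p' => simp [parseAux, hq] at h
    | none =>
      rw [repairT_run_cons]
      simpa [repairStep] using run_of_parseAux_none z .un (by simp) hq
  | false :: z, .un, _, h => by simp [parseAux] at h
  | _ :: _, .cp, hs, _ => absurd rfl hs

/-- **The re-pairing transducer computes `boolPair ∘ parse`.** [folklore] -/
theorem repairT_eval (z : List Bool) : repairT.eval z = boolPair (parse z).1 (parse z).2 := by
  unfold parse
  simp only [FST.eval, repairT_init, repairT_front, repairT_keep]
  cases hq : parseAux .ev z with
  | some p =>
    rw [run_of_parseAux_some z .ev p (by simp) hq]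
    simp
  | none =>
    have h := run_of_parseAux_none z .ev (by simp) hq
    simp [h, boolPair]

/-- **The post-processing of a classical sampler `A`**: parse the measured string `⟨x, 1^k⟩ 0 r`
and run `A` on `⟨x, 1^k⟩` with the coins `r`. [cite: BernsteinVazirani1997SICOMP, Thm. 8.3 (proof)] -/
def post (A : RandAlg (List Bool) (List Bool)) : List Bool → List Bool :=
  Function.uncurry A.run ∘ parse

/-- The post-processing runs `A` with the measured coins. [folklore] -/
theorem post_layout (A : RandAlg (List Bool) (List Bool)) (x : List Bool) (k : ℕ) (r : List Bool) :
    post A (boolPair x (unaryEncodeNat k) ++ false :: r) = A.run (boolPair x (unaryEncodeNat k)) r := by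
  simp [post, parse_layout]

/-- **The post-processing is polynomial time**: the parser, presented through `boolPair`, is the
finite-state transduction `repairT` (linear time, `FST.polyTimeComputable_eval`), and `A` runs in
polynomial time on `boolPair y r` (composition of machines, `PolyTimeComputable.comp_holds`).
(Arora–Barak 2009, §1.3; Bernstein–Vazirani 1997, proof of Thm. 8.3.) [cite: BernsteinVazirani1997SICOMP, Thm. 8.3 (proof)] -/
theorem post_polyTime {A : RandAlg (List Bool) (List Bool)} (hA : IsPPT A id) :
    PolyTimeComputable (id : List Bool → List Bool) (id : List Bool → List Bool) (post A) := by
  have hπ : PolyTimeComputable (id : List Bool → List Bool)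
      (fun p : List Bool × List Bool => boolPair (id p.1) p.2) parse := by
    obtain ⟨p, M, hM⟩ := repairT.polyTimeComputable_eval
    refine ⟨p, M, fun z => ?_⟩
    have h := hM z
    rw [id, repairT_eval] at h
    exact h
  exact PolyTimeComputable.comp_holds hA.1 hπ

/-! ### Uniformity of the separator–coin family -/

section Uniform

open BPPSim BPPSim.SimGen GExpr GStmt

/-- The wire of the `J`-th coin, `n + 1 + J`, as a counter expression. [folklore] -/
def coinWireE : SimExpr := add (add nE (const 1)) (var SVar.J)

/-- **The generator of the description stream** of the separator–coin family with coin budget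
`q`: the header (`n` in unary, separator, `2 (1 + q n)` ones for the ancilla count, separator),
then one Hadamard record on each coin wire `n + 1 + j`, `j < q n`.
(Arora–Barak 2009, §6.1–6.2, Def. 6.12: `P`-uniform descriptions.) [cite: AroraBarakCC2009, §6.2 Def. 6.12] -/
def genS (q : Polynomial ℕ) : SimStmt :=
  seqs [numS nE false, GStmt.emit (lits [false, true]),
    GStmt.loop SVar.J (add (const 1) (polyE q nE)) (GStmt.emit [Tok.lit true, Tok.lit true]),
    GStmt.emit (lits [false, true]),
    GStmt.loop SVar.J (polyE q nE) (g1S 0 coinWireE)]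

/-- A loop emitting a pair `t t` per round emits `2 N` copies of `t`. [folklore] -/
private theorem range_flatMap_pair (N : ℕ) (t : Tok) :
    ((List.range N).flatMap fun _ => [t, t]) = List.replicate (2 * N) t := by
  induction N with
  | zero => rfl
  | succ N ih =>
    rw [List.range_succ, List.flatMap_append, ih, Nat.mul_succ, List.replicate_add]
    simp

/-- **Tokens of the separator–coin circuit**: one `H` record on each wire `n + 1 + j`,
`j < m`. [cite: AroraBarakCC2009, §6.1] -/
theorem circTok_sepCoin (c : ℕ → ℕ) (n : ℕ) :
    circTok ((sepCoinFamily c).circ n) = (List.range (c n)).flatMap fun j => gate1Tok 0 (n + 1 + j) := by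
  rw [show circTok ((sepCoinFamily c).circ n) = ((coinWires n (c n)).map hOn).flatMap gateTok from rfl,
    coinWires, List.map_map, List.flatMap_map,
    ← finRange_flatMap_val (c n) fun j => gate1Tok 0 (n + 1 + j)]
  refine List.flatMap_congr fun (j : Fin (c n)) _ => ?_
  simp [gateTok_hOn]

/-- **The generator generates the description of the separator–coin family.**
[cite: AroraBarakCC2009, §6.2 Def. 6.12] -/
theorem out_genS (q : Polynomial ℕ) (n : ℕ) :
    (genS q).out (GenProg.initEnv SVar.N0 n) =
      descTok n (1 + q.eval n) ((sepCoinFamily fun n => q.eval n).circ n) := by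
  have hN : GenProg.initEnv SVar.N0 n SVar.N0 = n := GenProg.initEnv_self _ _
  rw [descTok, circTok_sepCoin, genS, out_seqs]
  simp only [List.flatMap_cons, List.flatMap_nil, List.append_nil, out_numS, eval_nE hN, GStmt.out,
    GExpr.eval, eval_polyE, out_g1S, List.append_assoc]
  have h1 : ((List.range (1 + q.eval n)).flatMap fun _ => [Tok.lit true, Tok.lit true]) =
      lits (List.replicate (2 * (1 + q.eval n)) true) := by
    rw [range_flatMap_pair]; simp [lits, List.map_replicate]
  have h2 : ((List.range (q.eval n)).flatMap fun k =>
      gate1Tok 0 (coinWireE.eval (Function.update (GenProg.initEnv SVar.N0 n) SVar.J k))) =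
      (List.range (q.eval n)).flatMap fun j => gate1Tok 0 (n + 1 + j) :=
    List.flatMap_congr fun j _ => by
      simp [coinWireE, GExpr.eval, eval_nE (hN_update hN SVar.J (by decide) j)]
  rw [h1, h2]

/-- The generator uses the loop indices `Z, J` only, never nested twice. [folklore] -/
theorem gok_genS (q : Polynomial ℕ) : GOK [SVar.Z, SVar.J] (genS q) :=
  gok_seqs fun x hx => by
    simp only [List.mem_cons, List.not_mem_nil, or_false] at hx
    rcases hx with rfl | rfl | rfl | rfl | rfl
    · exact gok_mono (gok_numS _ _) (by decide)
    · exact gok_emit _ _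
    · exact gok_loop (B := []) (gok_emit _ _) (by simp) (by simp) (by decide)
    · exact gok_emit _ _
    · exact gok_loop (gok_g1S 0 coinWireE) (by decide) (by decide) (by decide)

/-- **The separator–coin family with a polynomial coin budget is polynomial-time uniform**
(`QCircuitFamily.isUniform_of_gen`: generated description streams rendered in binary are
polynomial-time). (Arora–Barak 2009, Def. 6.12; Bernstein–Vazirani 1997, proof of Thm. 8.3:
the simulating device "can be computed in polynomial time".) [cite: AroraBarakCC2009, §6.2 Def. 6.12] -/
theorem sepCoinFamily_isUniform (c : ℕ → ℕ) (q : Polynomial ℕ) (hq : ∀ n, c n = q.eval n) :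
    (sepCoinFamily c).IsUniform := by
  obtain rfl : c = fun n => q.eval n := funext hq
  refine QCircuitFamily.isUniform_of_gen _ (genS q) SVar.N0 (fun h => ?_) (gok_genS q).1 (out_genS q)
  have := (gok_genS q).2 _ h
  simp at this

end Uniform

/-- The separator–coin family is oracle-free (its gates are Hadamard gates). [folklore] -/
theorem sepCoinFamily_isOracleFree (c : ℕ → ℕ) : (sepCoinFamily c).IsOracleFree := by
  intro n g hg
  obtain ⟨i, -, rfl⟩ := List.mem_map.1 hg
  exact hOn_isOracleFree i

end SampPSim

/-! ### Uniform `SampP` and the corrected inclusion -/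

/-- **Uniform `SampP`** (Aaronson–Arkhipov 2013, Def. 2.3: "a probabilistic polynomial-time
algorithm that, given `⟨x, 0^{1/ε}⟩`, samples from `D'_x` with `‖D'_x − D_x‖ ≤ ε`"): the tree's
`SampP` with the sampler required to be a *uniform* machine — `IsPPT A id` together with an
exactly polynomial coin budget `A.coinLen = q` (Gill's probabilistic machine; the idiom of
`UniformApproxBosonSampling`, `UniformIQPMultiplicativeSimulation`, `mem_BPP_iff_randAlg`).
Without this conjunct `IsPPT` only *bounds* `coinLen`, `RandAlg.outputPMF` feeds exactly
`coinLen |⟨x, 1^k⟩|` coins and `A.run` may count them, so the possibly non-computable number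
`coinLen n` is `O(log n)` bits of advice (see `UniformSampP_subset_SampBQP`).
[cite: AaronsonArkhipovToC2013, Def. 2.3 (p. 162)] -/
def UniformSampP : Set SamplingProblem :=
  {D | ∃ A : RandAlg (List Bool) (List Bool), IsPPT A id ∧
    (∃ q : Polynomial ℕ, ∀ n, A.coinLen n = q.eval n) ∧
    ∀ x k, 0 < k → (A.samplePMF x k).tvDist (D x) ≤ 1 / (k : ℝ)}

/-- Uniform samplers are samplers: `UniformSampP ⊆ SampP`. [folklore] -/
theorem UniformSampP_subset_SampP : UniformSampP ⊆ SampP :=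
  fun _ ⟨A, hA, _, h⟩ => ⟨A, hA, h⟩

/-- **`SampP ⊆ SampBQP` for uniform samplers** — corrected form of `SampP_subset_SampBQP`
(same source: Aaronson–Arkhipov 2013, Def. 2.3, the two classes; the inclusion is the sampling
analogue of `BPP ⊆ BQP`, Bernstein–Vazirani 1997 Thm. 8.3, and is used tacitly in the proof of
Aaronson–Arkhipov's Thm. 2.6 / Aaronson 2011, "`S ∈ SampBQP ⟹ … ⟹ S ∈ SampP`. Hence
`SampP = SampBQP`"): every sampling problem approximately sampled by a *uniform* probabilistic
polynomial-time algorithm is approximately sampled by a polynomial-time uniform quantum circuit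
family with polynomial-time classical post-processing.

Discrepancy with `SampP_subset_SampBQP` (`SamplingProblems.lean`, stated as `SampP ⊆ SampBQP`):
the tree's `SampP` quantifies over `RandAlg`s with `IsPPT A id`, which only bounds the coin
budget (`coinLen ≤ poly`, otherwise arbitrary) while `A.run` is fed, and can count, exactly
`coinLen |⟨x, 1^k⟩|` coins; so formal `SampP` contains targets with no computable structure —
e.g. for a non-computable `H : ℕ → Bool` take `coinLen n := ∑_{j ≤ log₂ n} H(j) 2^j ≤ 2n + 1`
and the polynomial-time `A.run ⟨x, 1^k⟩ r := [bit_{log₂|x|} |r|]` for `|x|` a power of two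
(`[0]` otherwise): `A.samplePMF x k = pure [H(log₂ |x|)]` exactly, for every `k` — whereas every
member of the tree's `SampBQP` (a `PolyTimeComputable` description `1ⁿ ↦ Cₙ`, Clifford+T
amplitudes in `ℚ(ζ₈)`, a `PolyTimeComputable` post-processing) has output laws computable to any
precision, so the bit carrying mass `≥ 2/3` at `k = 3` would compute `H`. Hence
`SampP ⊆ SampBQP` fails as formalised, while the source's `SampP` (Def. 2.3) is a class of
uniform machines; the corrected statement adds the exact-polynomial coin budget, exactly as the
corrected forms of quantum-advantage S20–S22 do (`QuantumComplexity/Sampling.lean`, module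
docstring). `SampP_subset_SampBQP` implies this statement
(`UniformSampP_subset_SampBQP_of_sampP_subset`), and this statement is proved below
(`UniformSampP_subset_SampBQP_holds`).
[cite: AaronsonArkhipovToC2013, Def. 2.3 (p. 162) with Thm. 2.6 (p. 163)] -/
def UniformSampP_subset_SampBQP : Prop :=
  UniformSampP ⊆ SampBQP

/-- The tree's (mis-stated, stronger) `SampP_subset_SampBQP` implies the corrected statement.
[folklore] -/
theorem UniformSampP_subset_SampBQP_of_sampP_subset (h : SampP_subset_SampBQP) :
    UniformSampP_subset_SampBQP :=
  UniformSampP_subset_SampP.trans h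

/-- **Discharge of `UniformSampP_subset_SampBQP`** (Bernstein–Vazirani 1997, proof of Thm. 8.3,
for samplers): given a uniform sampler `A` with coin budget `q`, take the separator–coin family
(`SampPSim.sepCoinFamily A.coinLen`: on input `y = ⟨x, 1^k⟩` one idle separator wire and a
Hadamard gate on each of the `q |y|` coin wires; polynomial-time uniform by
`SampPSim.sepCoinFamily_isUniform`) and the post-processing `SampPSim.post A` (parse the measured
string `y 0 r` and output `A.run y r`; polynomial time by `SampPSim.post_polyTime`). The measured
coins are uniform (`SampPSim.kernel_sepCoin_map`), so the post-processed output law on `⟨x, 1^k⟩`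
*equals* `A.samplePMF x k`, which is within `1/k` of `D_x` by hypothesis.
[cite: BernsteinVazirani1997SICOMP, Thm. 8.3 (proof)] -/
theorem UniformSampP_subset_SampBQP_holds : UniformSampP_subset_SampBQP := by
  rintro D ⟨A, hA, ⟨q, hq⟩, hD⟩
  refine ⟨SampPSim.sepCoinFamily A.coinLen, SampPSim.post A, SampPSim.sepCoinFamily_isOracleFree _,
    SampPSim.sepCoinFamily_isUniform A.coinLen q hq, SampPSim.post_polyTime hA, fun x k hk => ?_⟩
  have h : ((SampPSim.sepCoinFamily A.coinLen).samplePMF x k).map (SampPSim.post A) = A.samplePMF x k :=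
    SampPSim.kernel_sepCoin_map A _ _ (SampPSim.post_layout A x k)
  rw [h]
  exact hD x k hk

end Literature.Computability.Cryptography

end
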